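import Summits.ABC.ABC.Theorems.SoloBlindPolyABC
import Summits.ABC.ABC.Theorems.SoloBlindBakerXi
import HarnessLib

/-!
# The derivation lattice: abc ⟺ short arithmetic derivatives (solo-ABC-blind, T54)

Over `k[t]` the Mason–Stothers theorem is proved with ONE auxiliary object, the derivative
`(a′, b′)` of the pair `(a, b)`: it (i) vanishes to order `≥ v_p − 1` wherever `a` (resp. `b`,
resp. `c = a + b`, by additivity) vanishes to order `v_p`, (ii) is independent of `(a, b)`
(Wronskian `ab′ − a′b ≠ 0`), and (iii) is SHORT (`deg a′ ≤ deg a − 1`).  Over `ℤ` the pairs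
`(x, y) ∈ ℤ²` with property (i),

  `x · rad a ≡ 0 (mod a)`,  `y · rad b ≡ 0 (mod b)`,  `(x + y) · rad c ≡ 0 (mod c)`

form a lattice `Λ(a,b,c) ∋ (a, b)` of covolume `abc / rad(abc)` — the DERIVATION LATTICE of the
triple (written out as these three divisibilities in every statement below) — and the Wronskian
argument survives verbatim
(`abc_le_wronskian_mul_rad`): for `(x, y) ∈ Λ` with `ay ≠ bx`,

  `abc ≤ |ay − bx| · rad(abc) ≤ (a|y| + b|x|) · rad(abc)`.

What `ℤ` lacks is (iii), a CANONICAL short independent vector; pigeonhole supplies a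
non-canonical one of weighted size `a|y| + b|x| ≤ ab · (c / rad(abc) + 1)` and nothing better
(`exists_indep_derivative_le`).  This file certifies that the lack is the whole conjecture:

* `abc_iff_shortDerivatives` : `ABC ↔ ∀ ε > 0, ∃ K > 0,` every abc triple has `(x, y) ∈ Λ(a,b,c)`
  with `ay ≠ bx` and `a|y| + b|x| ≤ K · ab · c^ε`  ("short derivatives with exponent `ε`").

`→` is Dirichlet's pigeonhole in `Λ` (the covolume is small iff abc holds); `←` is the Wronskian
bound (through `PolyABC (1/(1−ε))` and `abc_iff_polyABC`).  So "an arithmetic derivative short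
enough to run Mason–Stothers exists for every triple" is not a tool towards abc but an exact
restatement of it, the conversion being geometry of numbers in dimension two.

Source and priority.  The idea that small arithmetic derivatives — Leibniz maps made additive on
the one equation `a + b = c`, produced by geometry of numbers — are EQUIVALENT to abc is due to
H. Pasten, *Arithmetic derivatives through geometry of numbers*, Canad. Math. Bull. (2021/22; doi:10.4153/S0008439521000990),
arXiv:2106.16165: derivations `ψ` on the primes, the arithmetic Wronskian `W^ψ(a,b)`, Thm. 3.3
(`c / log c ≤ rad(abc) · ‖ψ‖ / log 2`; the divisibility `a / rad a ∣ W` of his Lemma 3.4 is the one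
used below), Siegel's lemma for existence (Thm. 2.6, Lemma 3.5), and Cor. 4.6 (Masser–Oesterlé abc
⟹ Small Derivatives Conjecture ⟹ Oesterlé's abc), with exponent losses (Thm. 4.5:
`η > 1 − (2 − M)/(4M)`) and the family `(1, N, q)` excepted.  The statement here uses the full
rank-two lattice of jets `(x, y)` instead of the image `ψ ↦ (d^ψ a, d^ψ b)` and the weighted norm
`a|y| + b|x|`; in this normalisation the equivalence is exact in the exponent (`ε ↔ ε`), has no
exceptional family, and both directions are elementary.  No claim beyond this repackaging is made.
[Pasten2022 = arXiv:2106.16165, Thm. 3.3, Cor. 4.6; folklore]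
-/

open UniqueFactorizationMonoid Finset

namespace Summit.ABC.ABC.Theorems

open Literature.NumberTheory.DiophantineGeometry

/-! ### The Wronskian bound (Mason–Stothers' step, over `ℤ`) -/

/-- `abc ∣ (ay − bx) · rad(abc)` for `(x, y)` in the derivation lattice. [Pasten2022, Lemma 3.4 /
proof of Thm. 3.3; folklore] -/
theorem abc_dvd_wronskian_mul_rad {a b c : ℕ} (h : IsABCTriple a b c) {x y : ℤ}
    (hΛ : ((a : ℤ) ∣ x * (radical a : ℕ) ∧ (b : ℤ) ∣ y * (radical b : ℕ) ∧
      (c : ℤ) ∣ (x + y) * (radical c : ℕ))) :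
    ((a * b * c : ℕ) : ℤ) ∣ ((a : ℤ) * y - (b : ℤ) * x) * (rad a b c : ℕ) := by
  obtain ⟨hxa, hyb, hxyc⟩ := hΛ
  have habc := h.2.2.1
  have hcop := h.2.2.2
  -- pairwise coprimality and `rad(abc) = rad a · rad b · rad c`
  -- (cf. `IsABCTriple.coprime_left_right`, `AbcShapes.rad_eq_mul_of_isABCTriple` in Literature)
  have hac' : Nat.Coprime a c := by rw [← habc]; exact Nat.coprime_self_add_right.mpr hcop
  have hbc' : Nat.Coprime b c := by rw [← habc]; exact Nat.coprime_add_self_right.mpr hcop.symm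
  have hradN : rad a b c = radical a * radical b * radical c := by
    have hr := rad_eq_mul_of_isABCTriple h
    exact_mod_cast hr
  set W : ℤ := (a : ℤ) * y - (b : ℤ) * x with hWdef
  have hceq : (a : ℤ) = c - b := by push_cast [← habc]; ring
  have hWa : (a : ℤ) ∣ W * (radical a : ℕ) := by
    have : W * (radical a : ℕ) = (a : ℤ) * (y * (radical a : ℕ)) - (b : ℤ) * (x * (radical a : ℕ)) := by
      rw [hWdef]; ring
    rw [this]; exact dvd_sub (dvd_mul_right _ _) (dvd_mul_of_dvd_right hxa _)
  have hWb : (b : ℤ) ∣ W * (radical b : ℕ) := by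
    have : W * (radical b : ℕ) = (a : ℤ) * (y * (radical b : ℕ)) - (b : ℤ) * (x * (radical b : ℕ)) := by
      rw [hWdef]; ring
    rw [this]; exact dvd_sub (dvd_mul_of_dvd_right hyb _) (dvd_mul_right _ _)
  have hWc : (c : ℤ) ∣ W * (radical c : ℕ) := by
    have : W * (radical c : ℕ) = (c : ℤ) * (y * (radical c : ℕ)) - (b : ℤ) * ((x + y) * (radical c : ℕ)) := by
      rw [hWdef, hceq]; ring
    rw [this]; exact dvd_sub (dvd_mul_right _ _) (dvd_mul_of_dvd_right hxyc _)
  have hab : IsCoprime (a : ℤ) (b : ℤ) := Nat.isCoprime_iff_coprime.mpr hcop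
  have hac : IsCoprime (a : ℤ) (c : ℤ) := Nat.isCoprime_iff_coprime.mpr hac'
  have hbc : IsCoprime (b : ℤ) (c : ℤ) := Nat.isCoprime_iff_coprime.mpr hbc'
  set R : ℤ := ((radical a : ℕ) : ℤ) * (radical b : ℕ) * (radical c : ℕ) with hRdef
  have hWa' : (a : ℤ) ∣ W * R := by
    have : W * R = W * (radical a : ℕ) * ((radical b : ℕ) * (radical c : ℕ)) := by rw [hRdef]; ring
    rw [this]; exact dvd_mul_of_dvd_left hWa _
  have hWb' : (b : ℤ) ∣ W * R := by
    have : W * R = W * (radical b : ℕ) * ((radical a : ℕ) * (radical c : ℕ)) := by rw [hRdef]; ring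
    rw [this]; exact dvd_mul_of_dvd_left hWb _
  have hWc' : (c : ℤ) ∣ W * R := by
    have : W * R = W * (radical c : ℕ) * ((radical a : ℕ) * (radical b : ℕ)) := by rw [hRdef]; ring
    rw [this]; exact dvd_mul_of_dvd_left hWc _
  have habc : (a : ℤ) * b * c ∣ W * R :=
    IsCoprime.mul_dvd (IsCoprime.mul_left hac hbc) (IsCoprime.mul_dvd hab hWa' hWb') hWc'
  have hR : ((rad a b c : ℕ) : ℤ) = R := by rw [hradN, hRdef]; push_cast; ring
  rw [hR]; push_cast; exact habc

/-- **Wronskian bound.** For `(x, y)` in the derivation lattice with `ay ≠ bx`: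
`abc ≤ |ay − bx| · rad(abc)`. [Pasten2022, Thm. 3.3; folklore] -/
theorem abc_le_wronskian_mul_rad {a b c : ℕ} (h : IsABCTriple a b c) {x y : ℤ}
    (hΛ : ((a : ℤ) ∣ x * (radical a : ℕ) ∧ (b : ℤ) ∣ y * (radical b : ℕ) ∧
      (c : ℤ) ∣ (x + y) * (radical c : ℕ)))
    (hW : (a : ℤ) * y ≠ (b : ℤ) * x) :
    ((a * b * c : ℕ) : ℤ) ≤ |(a : ℤ) * y - (b : ℤ) * x| * (rad a b c : ℕ) := by
  have hd := abc_dvd_wronskian_mul_rad h hΛ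
  have hrad : (0 : ℤ) < (rad a b c : ℕ) := by
    rw [rad_def]; exact_mod_cast Nat.radical_pos _
  have hne : ((a : ℤ) * y - (b : ℤ) * x) * (rad a b c : ℕ) ≠ 0 :=
    mul_ne_zero (sub_ne_zero.mpr hW) hrad.ne'
  have := Int.le_of_dvd (abs_pos.mpr hne) ((dvd_abs _ _).mpr hd)
  rwa [abs_mul, abs_of_pos hrad] at this

/-- The Wronskian bound in weighted-norm form, over `ℝ`:
`abc ≤ (a|y| + b|x|) · rad(abc)`. [Pasten2022, Thm. 3.3; folklore] -/
theorem abc_le_norm_mul_rad {a b c : ℕ} (h : IsABCTriple a b c) {x y : ℤ}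
    (hΛ : ((a : ℤ) ∣ x * (radical a : ℕ) ∧ (b : ℤ) ∣ y * (radical b : ℕ) ∧
      (c : ℤ) ∣ (x + y) * (radical c : ℕ)))
    (hW : (a : ℤ) * y ≠ (b : ℤ) * x) :
    (a : ℝ) * b * c ≤ ((a : ℝ) * |(y : ℝ)| + (b : ℝ) * |(x : ℝ)|) * ((rad a b c : ℕ) : ℝ) := by
  have h1 := abc_le_wronskian_mul_rad h hΛ hW
  have h1' : (a : ℝ) * b * c ≤ |(a : ℝ) * y - (b : ℝ) * x| * ((rad a b c : ℕ) : ℝ) := by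
    have := (Int.cast_le (R := ℝ)).mpr h1
    push_cast [Int.cast_abs] at this
    exact this
  have h2 : |(a : ℝ) * y - (b : ℝ) * x| ≤ (a : ℝ) * |(y : ℝ)| + (b : ℝ) * |(x : ℝ)| := by
    calc |(a : ℝ) * y - (b : ℝ) * x| ≤ |(a : ℝ) * y| + |(b : ℝ) * x| := abs_sub _ _
      _ = (a : ℝ) * |(y : ℝ)| + (b : ℝ) * |(x : ℝ)| := by
        rw [abs_mul, abs_mul, Nat.abs_cast, Nat.abs_cast]
  exact h1'.trans (mul_le_mul_of_nonneg_right h2 (Nat.cast_nonneg _))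

/-! ### Short derivatives ⟹ abc -/

/-- Short derivatives with exponent `ε < 1` and constant `K` give `PolyABC (1/(1−ε))` with constant
`K^{1/(1−ε)}`.
[Pasten2022, Lemma 4.1 (in his normalisation); folklore] -/
theorem polyABC_of_shortDerivatives {ε K : ℝ} (hε1 : ε < 1) (hK : 0 < K)
    (h : (∀ a b c : ℕ, IsABCTriple a b c → ∃ x y : ℤ,
      ((a : ℤ) ∣ x * (radical a : ℕ) ∧ (b : ℤ) ∣ y * (radical b : ℕ) ∧
        (c : ℤ) ∣ (x + y) * (radical c : ℕ)) ∧ (a : ℤ) * y ≠ (b : ℤ) * x ∧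
      (a : ℝ) * |(y : ℝ)| + (b : ℝ) * |(x : ℝ)| ≤ K * ((a : ℝ) * b) * (c : ℝ) ^ ε)) :
    PolyABC (1 / (1 - ε)) := by
  have h1ε : 0 < 1 - ε := by linarith
  refine ⟨K ^ (1 / (1 - ε)), by positivity, fun a b c ht => ?_⟩
  obtain ⟨x, y, hΛ, hW, hN⟩ := h a b c ht
  have ha : (0 : ℝ) < a := by exact_mod_cast ht.1
  have hb : (0 : ℝ) < b := by exact_mod_cast ht.2.1
  have hc : (0 : ℝ) < c := by have := ht.2.2.1; have := ht.1; exact_mod_cast (by omega : 0 < c)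
  have hrad : (0 : ℝ) < ((rad a b c : ℕ) : ℝ) := by
    rw [rad_def]; exact_mod_cast Nat.radical_pos _
  set ρ : ℝ := ((rad a b c : ℕ) : ℝ) with hρ
  have h3 : (a : ℝ) * b * c ≤ K * ((a : ℝ) * b) * (c : ℝ) ^ ε * ρ :=
    (abc_le_norm_mul_rad ht hΛ hW).trans (mul_le_mul_of_nonneg_right hN hrad.le)
  have h4 : (c : ℝ) ≤ K * (c : ℝ) ^ ε * ρ := by
    have h3' : ((a : ℝ) * b) * c ≤ ((a : ℝ) * b) * (K * (c : ℝ) ^ ε * ρ) := by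
      calc ((a : ℝ) * b) * c = (a : ℝ) * b * c := by ring
        _ ≤ K * ((a : ℝ) * b) * (c : ℝ) ^ ε * ρ := h3
        _ = ((a : ℝ) * b) * (K * (c : ℝ) ^ ε * ρ) := by ring
    exact le_of_mul_le_mul_left h3' (by positivity)
  have h5 : (c : ℝ) ^ (1 - ε) ≤ K * ρ := by
    rw [Real.rpow_sub hc, Real.rpow_one, div_le_iff₀ (Real.rpow_pos_of_pos hc ε)]
    calc (c : ℝ) ≤ K * (c : ℝ) ^ ε * ρ := h4
      _ = K * ρ * (c : ℝ) ^ ε := by ring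
  have h6 : ((c : ℝ) ^ (1 - ε)) ^ (1 / (1 - ε)) ≤ (K * ρ) ^ (1 / (1 - ε)) :=
    Real.rpow_le_rpow (by positivity) h5 (by positivity)
  have h7 : ((c : ℝ) ^ (1 - ε)) ^ (1 / (1 - ε)) = c := by
    rw [← Real.rpow_mul hc.le, mul_one_div_cancel h1ε.ne', Real.rpow_one]
  rw [h7, Real.mul_rpow hK.le hrad.le] at h6
  exact h6

/-- Short derivatives for every `ε > 0` imply abc. [Pasten2022, Cor. 4.6 (his normalisation);
folklore] -/
theorem abc_of_shortDerivatives
    (h : ∀ ε : ℝ, 0 < ε → ∃ K : ℝ, 0 < K ∧ (∀ a b c : ℕ, IsABCTriple a b c → ∃ x y : ℤ,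
      ((a : ℤ) ∣ x * (radical a : ℕ) ∧ (b : ℤ) ∣ y * (radical b : ℕ) ∧
        (c : ℤ) ∣ (x + y) * (radical c : ℕ)) ∧ (a : ℤ) * y ≠ (b : ℤ) * x ∧
      (a : ℝ) * |(y : ℝ)| + (b : ℝ) * |(x : ℝ)| ≤ K * ((a : ℝ) * b) * (c : ℝ) ^ ε)) : ABC := by
  rw [abc_iff_polyABC]
  intro M hM
  have hM0 : 0 < M := by linarith
  have hε0 : 0 < 1 - 1 / M := by
    have : 1 / M < 1 := by rw [div_lt_one hM0]; exact hM
    linarith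
  have h1M : 0 < 1 / M := by positivity
  have hε1 : 1 - 1 / M < 1 := by linarith
  obtain ⟨K, hK, hS⟩ := h (1 - 1 / M) hε0
  have hP := polyABC_of_shortDerivatives hε1 hK hS
  have hMeq : 1 / (1 - (1 - 1 / M)) = M := by rw [sub_sub_cancel, one_div_one_div]
  rwa [hMeq] at hP

/-! ### abc ⟹ short derivatives: pigeonhole in the derivation lattice -/

/-- **Unconditional existence (pigeonhole).** Every abc triple has an independent arithmetic
derivative `(x, y) ∈ Λ(a,b,c)`, `ay ≠ bx`, of weighted size
`a|y| + b|x| ≤ ab · c / rad(abc) + ab`.  (By `abc_le_norm_mul_rad` every such vector has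
`a|y| + b|x| ≥ abc / rad(abc)`: the shortest derivative measures the quality.)
[Pasten2022, Thm. 2.6 / Lemma 3.5 via Siegel's lemma, in his normalisation; folklore] -/
theorem exists_indep_derivative_le {a b c : ℕ} (ht : IsABCTriple a b c) :
    ∃ x y : ℤ, ((a : ℤ) ∣ x * (radical a : ℕ) ∧ (b : ℤ) ∣ y * (radical b : ℕ) ∧
      (c : ℤ) ∣ (x + y) * (radical c : ℕ)) ∧ (a : ℤ) * y ≠ (b : ℤ) * x ∧
      (a : ℝ) * |(y : ℝ)| + (b : ℝ) * |(x : ℝ)| ≤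
        (a : ℝ) * b * (c / ((rad a b c : ℕ) : ℝ)) + (a : ℝ) * b := by
  have ha := ht.1
  have hb := ht.2.1
  have hc : 0 < c := by have := ht.2.2.1; omega
  have hcop := ht.2.2.2
  obtain ⟨A, hA⟩ : radical a ∣ a := radical_dvd_self
  obtain ⟨B, hB⟩ : radical b ∣ b := radical_dvd_self
  obtain ⟨D, hD⟩ : radical c ∣ c := radical_dvd_self
  have hra := Nat.radical_pos a
  have hrb := Nat.radical_pos b
  have hrc := Nat.radical_pos c
  have hA0 : 0 < A := Nat.pos_of_ne_zero (fun h0 => by rw [h0, mul_zero] at hA; omega)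
  have hB0 : 0 < B := Nat.pos_of_ne_zero (fun h0 => by rw [h0, mul_zero] at hB; omega)
  have hD0 : 0 < D := Nat.pos_of_ne_zero (fun h0 => by rw [h0, mul_zero] at hD; omega)
  -- pigeonhole: `rad a · (D / rad a + 1) > D` pairs `(i, j)`, residues of `A i + B j` mod `D`
  set L : ℕ := D / radical a + 1 with hL
  set S : Finset (ℕ × ℕ) := range (radical a) ×ˢ range L with hS
  have hcard : (range D).card < S.card := by
    rw [hS, card_product, card_range, card_range, card_range, hL]
    exact Nat.lt_mul_div_succ D hra
  have hmaps : ∀ ij ∈ S, (fun ij : ℕ × ℕ => (A * ij.1 + B * ij.2) % D) ij ∈ range D :=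
    fun ij _ => mem_range.mpr (Nat.mod_lt _ hD0)
  obtain ⟨⟨i, j⟩, hij, ⟨i', j'⟩, hij', hne, hfeq⟩ :=
    exists_ne_map_eq_of_card_lt_of_maps_to hcard hmaps
  simp only [hS, mem_product, mem_range] at hij hij'
  obtain ⟨hi, hj⟩ := hij
  obtain ⟨hi', hj'⟩ := hij'
  -- the difference vector
  refine ⟨(A : ℤ) * ((i : ℤ) - i'), (B : ℤ) * ((j : ℤ) - j'), ⟨?_, ?_, ?_⟩, ?_, ?_⟩
  · -- a ∣ x · rad a
    have hAz : (a : ℤ) = ((radical a : ℕ) : ℤ) * (A : ℤ) := by exact_mod_cast hA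
    refine ⟨(i : ℤ) - i', ?_⟩
    rw [hAz]; ring
  · have hBz : (b : ℤ) = ((radical b : ℕ) : ℤ) * (B : ℤ) := by exact_mod_cast hB
    refine ⟨(j : ℤ) - j', ?_⟩
    rw [hBz]; ring
  · -- c ∣ (x + y) · rad c from the equal residues mod D
    have hmod : (D : ℤ) ∣ ((A * i + B * j : ℕ) : ℤ) - ((A * i' + B * j' : ℕ) : ℤ) :=
      Nat.modEq_iff_dvd.mp (Nat.ModEq.symm hfeq)
    have hxy : (A : ℤ) * ((i : ℤ) - i') + (B : ℤ) * ((j : ℤ) - j') =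
        ((A * i + B * j : ℕ) : ℤ) - ((A * i' + B * j' : ℕ) : ℤ) := by push_cast; ring
    have hDz : (c : ℤ) = ((radical c : ℕ) : ℤ) * (D : ℤ) := by exact_mod_cast hD
    rw [hxy, hDz, mul_comm (((A * i + B * j : ℕ) : ℤ) - ((A * i' + B * j' : ℕ) : ℤ)) _]
    exact mul_dvd_mul_left _ hmod
  · -- independence: ay = bx forces a ∣ x, but |x| < a
    intro hEq
    have hdvd : (a : ℤ) ∣ (b : ℤ) * ((A : ℤ) * ((i : ℤ) - i')) := ⟨_, hEq.symm⟩
    have hax : (a : ℤ) ∣ (A : ℤ) * ((i : ℤ) - i') :=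
      (Nat.isCoprime_iff_coprime.mpr hcop).dvd_of_dvd_mul_left hdvd
    have hlt : ((A : ℤ) * ((i : ℤ) - i')).natAbs < (a : ℤ).natAbs := by
      rw [Int.natAbs_mul, Int.natAbs_natCast, Int.natAbs_natCast, hA, mul_comm (radical a) A]
      apply Nat.mul_lt_mul_of_pos_left _ hA0
      omega
    have hx0 : (A : ℤ) * ((i : ℤ) - i') = 0 := Int.eq_zero_of_dvd_of_natAbs_lt_natAbs hax hlt
    have hii : i = i' := by
      rcases mul_eq_zero.mp hx0 with hA' | hii
      · exact absurd (by exact_mod_cast hA' : A = 0) hA0.ne'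
      · omega
    have hy0 : (a : ℤ) * ((B : ℤ) * ((j : ℤ) - j')) = 0 := by rw [hEq, hx0, mul_zero]
    have hjj : j = j' := by
      rcases mul_eq_zero.mp hy0 with ha' | hBy
      · exact absurd (by exact_mod_cast ha' : a = 0) ha.ne'
      · rcases mul_eq_zero.mp hBy with hB' | hjj
        · exact absurd (by exact_mod_cast hB' : B = 0) hB0.ne'
        · omega
    exact hne (by rw [hii, hjj])
  · -- the size bound
    have haR : (0 : ℝ) < a := by exact_mod_cast ha
    have hbR : (0 : ℝ) < b := by exact_mod_cast hb
    have hraR : (0 : ℝ) < (radical a : ℕ) := by exact_mod_cast hra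
    have hrbR : (0 : ℝ) < (radical b : ℕ) := by exact_mod_cast hrb
    have hrcR : (0 : ℝ) < (radical c : ℕ) := by exact_mod_cast hrc
    have hAr : (a : ℝ) = ((radical a : ℕ) : ℝ) * (A : ℝ) := by exact_mod_cast hA
    have hBr : (b : ℝ) = ((radical b : ℕ) : ℝ) * (B : ℝ) := by exact_mod_cast hB
    have hDr : (c : ℝ) = ((radical c : ℕ) : ℝ) * (D : ℝ) := by exact_mod_cast hD
    have hAR : (A : ℝ) = a / (radical a : ℕ) := by
      rw [eq_div_iff hraR.ne', hAr]; ring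
    have hBR : (B : ℝ) = b / (radical b : ℕ) := by
      rw [eq_div_iff hrbR.ne', hBr]; ring
    have hDR : (D : ℝ) = c / (radical c : ℕ) := by
      rw [eq_div_iff hrcR.ne', hDr]; ring
    have hρ : ((rad a b c : ℕ) : ℝ) = (radical a : ℕ) * (radical b : ℕ) * (radical c : ℕ) :=
      rad_eq_mul_of_isABCTriple ht
    have hii : |((i : ℝ) - i')| ≤ (radical a : ℕ) := by
      have h1 : (i : ℝ) ≤ (radical a : ℕ) := by exact_mod_cast hi.le
      have h2 : (i' : ℝ) ≤ (radical a : ℕ) := by exact_mod_cast hi'.le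
      rw [abs_sub_le_iff]; constructor <;> linarith [(Nat.cast_nonneg i : (0:ℝ) ≤ i), (Nat.cast_nonneg i' : (0:ℝ) ≤ i')]
    have hjj : |((j : ℝ) - j')| ≤ ((D / radical a : ℕ) : ℝ) := by
      have h1 : (j : ℝ) ≤ ((D / radical a : ℕ) : ℝ) := by exact_mod_cast (by omega : j ≤ D / radical a)
      have h2 : (j' : ℝ) ≤ ((D / radical a : ℕ) : ℝ) := by exact_mod_cast (by omega : j' ≤ D / radical a)
      rw [abs_sub_le_iff]; constructor <;> linarith [(Nat.cast_nonneg j : (0:ℝ) ≤ j), (Nat.cast_nonneg j' : (0:ℝ) ≤ j')]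
    have hQ : ((D / radical a : ℕ) : ℝ) ≤ (D : ℝ) / (radical a : ℕ) := Nat.cast_div_le
    -- |y| and |x|
    have hy : |(((B : ℤ) * ((j : ℤ) - j') : ℤ) : ℝ)| ≤ (B : ℝ) * ((D : ℝ) / (radical a : ℕ)) := by
      push_cast
      rw [abs_mul, abs_of_nonneg (Nat.cast_nonneg B)]
      exact mul_le_mul_of_nonneg_left (hjj.trans hQ) (Nat.cast_nonneg B)
    have hx : |(((A : ℤ) * ((i : ℤ) - i') : ℤ) : ℝ)| ≤ (A : ℝ) * (radical a : ℕ) := by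
      push_cast
      rw [abs_mul, abs_of_nonneg (Nat.cast_nonneg A)]
      exact mul_le_mul_of_nonneg_left hii (Nat.cast_nonneg A)
    have key : (a : ℝ) * ((B : ℝ) * ((D : ℝ) / (radical a : ℕ))) + (b : ℝ) * ((A : ℝ) * (radical a : ℕ))
        = (a : ℝ) * b * (c / ((rad a b c : ℕ) : ℝ)) + (a : ℝ) * b := by
      rw [hBR, hDR, hAR, hρ]
      field_simp
    calc (a : ℝ) * |(((B : ℤ) * ((j : ℤ) - j') : ℤ) : ℝ)| + (b : ℝ) * |(((A : ℤ) * ((i : ℤ) - i') : ℤ) : ℝ)|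
        ≤ (a : ℝ) * ((B : ℝ) * ((D : ℝ) / (radical a : ℕ))) + (b : ℝ) * ((A : ℝ) * (radical a : ℕ)) :=
          add_le_add (mul_le_mul_of_nonneg_left hy haR.le) (mul_le_mul_of_nonneg_left hx hbR.le)
      _ = (a : ℝ) * b * (c / ((rad a b c : ℕ) : ℝ)) + (a : ℝ) * b := key

/-- `rad(abc) ≤ c³` for an abc triple. [folklore] -/
theorem rad_le_cube {a b c : ℕ} (ht : IsABCTriple a b c) : ((rad a b c : ℕ) : ℝ) ≤ (c : ℝ) ^ 3 := by
  have ha := ht.1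
  have hb := ht.2.1
  have habc := ht.2.2.1
  have hc : 0 < c := by omega
  have hpos : 0 < a * b * c := by positivity
  have h1 : rad a b c ≤ a * b * c := by
    rw [rad_def]; exact Nat.le_of_dvd hpos radical_dvd_self
  have h2 : a * b * c ≤ c ^ 3 := by
    have hac : a ≤ c := by omega
    have hbc : b ≤ c := by omega
    calc a * b * c ≤ c * c * c := by gcongr
      _ = c ^ 3 := by ring
  exact_mod_cast h1.trans h2

/-- abc implies short derivatives for every `ε > 0` (constant `C_{ε/3} + 1`). [Pasten2022, Thm. 4.5
(his normalisation, with losses); folklore] -/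
theorem shortDerivatives_of_abc (habc : ABC) :
    ∀ ε : ℝ, 0 < ε → ∃ K : ℝ, 0 < K ∧ (∀ a b c : ℕ, IsABCTriple a b c → ∃ x y : ℤ,
      ((a : ℤ) ∣ x * (radical a : ℕ) ∧ (b : ℤ) ∣ y * (radical b : ℕ) ∧
        (c : ℤ) ∣ (x + y) * (radical c : ℕ)) ∧ (a : ℤ) * y ≠ (b : ℤ) * x ∧
      (a : ℝ) * |(y : ℝ)| + (b : ℝ) * |(x : ℝ)| ≤ K * ((a : ℝ) * b) * (c : ℝ) ^ ε) := by
  intro ε hε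
  obtain ⟨C, hC, H⟩ := habc (ε / 3) (by positivity)
  refine ⟨C + 1, by positivity, fun a b c ht => ?_⟩
  obtain ⟨x, y, hΛ, hW, hN⟩ := exists_indep_derivative_le ht
  refine ⟨x, y, hΛ, hW, hN.trans ?_⟩
  have ha : (0 : ℝ) < a := by exact_mod_cast ht.1
  have hb : (0 : ℝ) < b := by exact_mod_cast ht.2.1
  have hc1 : (1 : ℝ) ≤ c := by
    have := ht.2.2.1; have := ht.1; exact_mod_cast (by omega : 1 ≤ c)
  have hc : (0 : ℝ) < c := by linarith
  have hrad : (0 : ℝ) < ((rad a b c : ℕ) : ℝ) := by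
    rw [rad_def]; exact_mod_cast Nat.radical_pos _
  set ρ : ℝ := ((rad a b c : ℕ) : ℝ) with hρ
  -- abc with ε/3 and `rad ≤ c³` give `c ≤ C ρ c^ε`, i.e. `c / ρ ≤ C c^ε`
  have h1 : (c : ℝ) < C * ρ ^ (1 + ε / 3) := H a b c ht
  have h2 : ρ ^ (1 + ε / 3) ≤ ρ * (c : ℝ) ^ ε := by
    rw [Real.rpow_add hrad, Real.rpow_one]
    apply mul_le_mul_of_nonneg_left _ hrad.le
    calc ρ ^ (ε / 3) ≤ ((c : ℝ) ^ (3 : ℕ)) ^ (ε / 3) :=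
          Real.rpow_le_rpow hrad.le (rad_le_cube ht) (by positivity)
      _ = (c : ℝ) ^ ε := by
          rw [← Real.rpow_natCast, ← Real.rpow_mul hc.le]; congr 1; push_cast; ring
  have h3 : (c : ℝ) / ρ ≤ C * (c : ℝ) ^ ε := by
    rw [div_le_iff₀ hrad]
    calc (c : ℝ) ≤ C * ρ ^ (1 + ε / 3) := h1.le
      _ ≤ C * (ρ * (c : ℝ) ^ ε) := mul_le_mul_of_nonneg_left h2 hC.le
      _ = C * (c : ℝ) ^ ε * ρ := by ring
  have h4 : (1 : ℝ) ≤ (c : ℝ) ^ ε := Real.one_le_rpow hc1 hε.le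
  have hab : (0 : ℝ) ≤ (a : ℝ) * b := by positivity
  calc (a : ℝ) * b * (c / ρ) + (a : ℝ) * b
      ≤ (a : ℝ) * b * (C * (c : ℝ) ^ ε) + (a : ℝ) * b * (c : ℝ) ^ ε := by
        apply add_le_add (mul_le_mul_of_nonneg_left h3 hab)
        calc (a : ℝ) * b = (a : ℝ) * b * 1 := (mul_one _).symm
          _ ≤ (a : ℝ) * b * (c : ℝ) ^ ε := mul_le_mul_of_nonneg_left h4 hab
    _ = (C + 1) * ((a : ℝ) * b) * (c : ℝ) ^ ε := by ring

/-- **abc ⟺ short arithmetic derivatives.**  `ABC` holds iff for every `ε > 0` there is `K > 0`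
such that every abc triple `(a, b, c)` admits `(x, y)` in its derivation lattice, independent of
`(a, b)`, with `a|y| + b|x| ≤ K · ab · c^ε`.  [Pasten2022 = arXiv:2106.16165, Cor. 4.6, in the
lattice normalisation of this file (exact exponents, no exceptional family); folklore] -/
theorem abc_iff_shortDerivatives :
    ABC ↔ ∀ ε : ℝ, 0 < ε → ∃ K : ℝ, 0 < K ∧ (∀ a b c : ℕ, IsABCTriple a b c → ∃ x y : ℤ,
      ((a : ℤ) ∣ x * (radical a : ℕ) ∧ (b : ℤ) ∣ y * (radical b : ℕ) ∧
        (c : ℤ) ∣ (x + y) * (radical c : ℕ)) ∧ (a : ℤ) * y ≠ (b : ℤ) * x ∧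
      (a : ℝ) * |(y : ℝ)| + (b : ℝ) * |(x : ℝ)| ≤ K * ((a : ℝ) * b) * (c : ℝ) ^ ε) :=
  ⟨shortDerivatives_of_abc, abc_of_shortDerivatives⟩

end Summit.ABC.ABC.Theorems
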